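import Summits.KontsevichZagierPeriods.KontsevichZagierPeriods.Theorems.TorsionLogsNeronTorsionFlexRealSigma
import Summits.KontsevichZagierPeriods.KontsevichZagierPeriods.Theorems.TorsionLogsNeronTorsionFlexQuasiPeriod
import Summits.KontsevichZagierPeriods.KontsevichZagierPeriods.Theorems.TorsionLogsNeronTorsionFlexRepValues
import Summits.KontsevichZagierPeriods.KontsevichZagierPeriods.Theorems.TorsionLogsNeronTorsionFlexDuplicationValue

/-!
# The Néron–torsion value identity (crux `TorsionLogs.NeronTorsionFlex`, line `NeronHeight`)

Crux `TorsionLogs.NeronTorsionFlex` (stmt-KontsevichZagierPeriods-13806), registered line `NeronHeight`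
(`Cruxes/NeronTorsionFlex/Lines/NeronHeight.lean`, 2026-08-19): its rung `NeronTorsionHeightChain` is
the PROVED floor `NeronTorsionPrimitiveChain` (`Cruxes.NeronTorsionSector.Translation.stub_assembly`)
with the log carrier pinned, and the line's on-path workfile `Lines/NeronHeight_onpath.lean` reduces
the rung to ONE classical value identity, `NeronTorsionValueIdentity` — the archimedean Néron local
height of a real `N`-torsion point of the identity component read in the tree's integral language:

  `(N−2)·(4N²·rI.value + (N−2a)²·rP.value) = 4N·log|ψ_{N−1}(x_P, y_P/2)| − N²(N−2)·log(3e₁² − g₂/4)`.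

This file PROVES that identity (`neronTorsion_value_identity`, verbatim the body of
`Lines/NeronHeight_onpath.lean :: NeronTorsionValueIdentity`), for every real curve
`y² = f(x) = 4x³ − g₂x − g₃` (`Δ ≠ 0`, largest root `e₁ > 0`), every point `x_P > e₁` whose real
elliptic logarithm `u_P = ∫_{x_P}^∞ dx/√f` satisfies `N·u_P = a·Ω₀` (`Ω₀ = 2∫_{e₁}^∞ dx/√f`,
`0 < a < N/2`, `N ≥ 3`), and the two representations `rI = ∫∫_{e₁<x′<x<x_P} x′/(√f√f)`,
`rP = ∫∫_{x,x′>e₁} (√f(x))⁻¹(g₂x′+2g₃)/(2x′²√f(x′))`.  (The torsion hypothesis on `addOrderOf` is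
carried but not used: the period relation `N·u_P = a·Ω₀` is all the analysis needs.)

Proof.  With `Λ` the real lattice of invariants `g₂, g₃`, `T = Ω₀/2`, `η = Re η(Ω₀) = 2 Re ζ(T)`:
`rI = log‖σ(T)‖ − log‖σ(u_P)‖ − (η/2)(T − u_P)`, `rP = Tη` (landed real dictionary of line
`NeronDuplication`: `iterated_integral_weierstrassPRe`, `value_triangle_eq`, `value_quadrant_eq`,
`integral_quasiPeriodDensity_eq`), `4 log‖σ(T)‖ + log(3e₁² − g₂/4) = ηT`
(`four_mul_log_norm_weierstrassSigma_half`).  The new input is the division formula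
`σ(nz) = (−1)^{n+1} ψₙ(℘z, ℘′z/2) σ(z)^{n²}` (`PeriodPair.weierstrassSigma_nat_mul`,
`Literature/NumberTheory/EllipticCurves/WeierstrassSigmaDivision.lean`) on the real axis
(`norm_weierstrassSigma_nat_mul_real`, via the base change `E_Λ = E_ℝ ×_ℝ ℂ`, `evalEval_ψ_ofReal`) at
`n = N − 1`, `z = u_P`: since `(N−1)u_P = aΩ₀ − u_P`, the quasi-periodicity
`‖σ(z + ω)‖ = e^{Re(η(ω)(z + ω/2))}‖σ(z)‖` (`PeriodPair.norm_weierstrassSigma_add_of_mem`) and oddness give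
`log|ψ_{N−1}(x_P, ℘′(u_P)/2)| = aη(aT − u_P) − (N² − 2N)·log‖σ(u_P)‖`
(`log_abs_evalEval_ψ_of_period`), and the sign of `y_P = ±℘′(u_P)` is immaterial
(`abs_evalEval_ψ_neg`: `|ψₙ(x, −y)| = |ψₙ(x, y)|` on the real identity component, by the same two
formulas at `z` and `Ω₀ − z`).  The rest is linear algebra over `N·u_P = 2aT`.
[Silverman 1994 (ATAEC) Thm VI.1.1, VI.3.2, Ex. 6.3; Silverman 2009 (AEC) Ex. 6.15; Lang 1978 Ch. I–II]

prover-fwd2-land-3-g8-0 (on-path lander, gen 8), 2026-08-19.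
-/

-- single-conjunct summit: Sub = Summit, so the namespace segment repeats by design (CONVENTIONS §2)
set_option linter.dupNamespace false

noncomputable section

open Set MeasureTheory Filter Topology Complex Polynomial
open scoped PeriodPair Polynomial.Bivariate
open Literature.NumberTheory.Transcendental
open Summit.KontsevichZagierPeriods.KontsevichZagierPeriods.Cruxes.NeronTorsionSector.Translation
  (weierstrassPRe_half_eq integral_Ioi_weierstrassPRe_eq)
open Summit.KontsevichZagierPeriods.KontsevichZagierPeriods.TorsionLogs.NeronDuplication

namespace Summit.KontsevichZagierPeriods.KontsevichZagierPeriods.TorsionLogs.NeronHeight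

variable {L : PeriodPair}

/-! ### The division polynomials of `E_Λ` on the real axis -/

/-- For a real lattice, `E_Λ : y² = x³ − (g₂/4)x − g₃/4` is the base change to `ℂ` of the real
Weierstrass curve with the same (real) coefficients. [folklore] -/
theorem curve_eq_map (hR : L.IsReal) :
    L.curve = (⟨0, 0, 0, -L.g₂.re / 4, -L.g₃.re / 4⟩ : WeierstrassCurve ℝ).map (algebraMap ℝ ℂ) := by
  ext <;> simp [PeriodPair.curve, WeierstrassCurve.map, hR.ofReal_g₂_re, hR.ofReal_g₃_re]

/-- For a real lattice the complex division polynomial `ψₙ` of `E_Λ` at a real point is the real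
division polynomial of the real curve at that point (`ψₙ` commutes with base change,
`WeierstrassCurve.map_ψ`). [folklore] -/
theorem evalEval_ψ_ofReal (hR : L.IsReal) (n : ℤ) (x y : ℝ) :
    (L.curve.ψ n).evalEval (x : ℂ) (y : ℂ) =
      ((((⟨0, 0, 0, -L.g₂.re / 4, -L.g₃.re / 4⟩ : WeierstrassCurve ℝ).ψ n).evalEval x y : ℝ) : ℂ) := by
  rw [curve_eq_map hR, WeierstrassCurve.map_ψ]
  exact Polynomial.map_mapRingHom_evalEval (algebraMap ℝ ℂ) _ x y

/-- **The division formula in absolute value on the real axis**: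
`‖σ(nt)‖ = |ψₙ(X t, Y t/2)| · ‖σ(t)‖^{n²}` for real `t`, `X = ℘|ℝ`, `Y = ℘′|ℝ`
(`σ(nz) = (−1)^{n+1}ψₙ(℘z, ℘′z/2)σ(z)^{n²}`). [cite: SilvermanAEC2009, Exercise 6.15] -/
theorem norm_weierstrassSigma_nat_mul_real (hR : L.IsReal) (n : ℕ) (t : ℝ) :
    ‖L.weierstrassSigma ((n * t : ℝ) : ℂ)‖ =
      |((⟨0, 0, 0, -L.g₂.re / 4, -L.g₃.re / 4⟩ : WeierstrassCurve ℝ).ψ n).evalEval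
          (L.weierstrassPRe t) (L.derivWeierstrassPRe t / 2)| *
        ‖L.weierstrassSigma t‖ ^ (n ^ 2) := by
  have h := L.weierstrassSigma_nat_mul n t
  rw [← hR.ofReal_weierstrassPRe, ← hR.ofReal_derivWeierstrassPRe,
    show ((L.derivWeierstrassPRe t : ℝ) : ℂ) / 2 = ((L.derivWeierstrassPRe t / 2 : ℝ) : ℂ) by
      push_cast; ring,
    evalEval_ψ_ofReal hR] at h
  push_cast
  rw [h, norm_mul, norm_mul, norm_pow, norm_pow, norm_neg, norm_one, one_pow, one_mul,
    Complex.norm_real, Real.norm_eq_abs]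

/-- **Quasi-periodicity of `‖σ‖` along a multiple of the real period, reflected form**: for real `w`
and `b ∈ ℕ`, `‖σ(bΩ₀ − w)‖ = e^{b·Re η(Ω₀)·(bΩ₀/2 − w)}·‖σ(w)‖` (`‖σ(z + ω)‖ = e^{Re(η(ω)(z+ω/2))}‖σ(z)‖`
at `z = −w`, `ω = bΩ₀`, and oddness of `σ`). [cite: Silverman1994, Prop VI.3.1] -/
theorem norm_weierstrassSigma_nat_mul_sub (hR : L.IsReal) (b : ℕ) (w : ℝ) :
    ‖L.weierstrassSigma ((b * L.minRealPeriod - w : ℝ) : ℂ)‖ =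
      Real.exp (b * (L.quasiPeriodMap L.minRealPeriod).re * (b * (L.minRealPeriod / 2) - w)) *
        ‖L.weierstrassSigma w‖ := by
  have hω : ((b : ℂ) * L.minRealPeriod) ∈ L.lattice := by
    simpa [nsmul_eq_mul] using nsmul_mem hR.minRealPeriod_mem_lattice b
  have h := L.norm_weierstrassSigma_add_of_mem hω (-(w : ℂ))
  rw [L.weierstrassSigma_neg, norm_neg] at h
  have hη : L.quasiPeriodMap ((b : ℂ) * L.minRealPeriod) =
      (b : ℂ) * L.quasiPeriodMap L.minRealPeriod := by
    have e : ((b : ℂ) * L.minRealPeriod) = (b : ℝ) • ((L.minRealPeriod : ℝ) : ℂ) := by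
      rw [Complex.real_smul]; push_cast; ring
    rw [e, LinearMap.map_smul, Complex.real_smul]; push_cast; ring
  have hexp : (L.quasiPeriodMap ((b : ℂ) * L.minRealPeriod) *
        (-(w : ℂ) + (b : ℂ) * L.minRealPeriod / 2)).re =
      b * (L.quasiPeriodMap L.minRealPeriod).re * (b * (L.minRealPeriod / 2) - w) := by
    rw [hη, show (b : ℂ) * L.quasiPeriodMap L.minRealPeriod * (-(w : ℂ) + (b : ℂ) * L.minRealPeriod / 2) =
      L.quasiPeriodMap L.minRealPeriod * ((b * (b * (L.minRealPeriod / 2) - w) : ℝ) : ℂ) by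
        push_cast; ring, Complex.re_mul_ofReal]
    ring
  have e : ((b * L.minRealPeriod - w : ℝ) : ℂ) = -(w : ℂ) + (b : ℂ) * L.minRealPeriod := by
    push_cast; ring
  rw [e, h, hexp]

/-- **`|ψₙ(x, −y)| = |ψₙ(x, y)|` on the real identity component**: for real `t ∈ (0, Ω₀)`,
`|ψₙ(X t, −Y t/2)| = |ψₙ(X t, Y t/2)|`.  Proof: `(X t, −Y t) = (X, Y)(Ω₀ − t)`; the division formula at
`t` and at `Ω₀ − t` and the quasi-periodicity of `‖σ‖` under `nΩ₀` give the same quotient. [folklore] -/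
theorem abs_evalEval_ψ_neg (hR : L.IsReal) {t : ℝ} (ht : t ∈ Ioo 0 L.minRealPeriod) (n : ℕ) :
    |((⟨0, 0, 0, -L.g₂.re / 4, -L.g₃.re / 4⟩ : WeierstrassCurve ℝ).ψ n).evalEval
        (L.weierstrassPRe t) (-L.derivWeierstrassPRe t / 2)| =
      |((⟨0, 0, 0, -L.g₂.re / 4, -L.g₃.re / 4⟩ : WeierstrassCurve ℝ).ψ n).evalEval
        (L.weierstrassPRe t) (L.derivWeierstrassPRe t / 2)| := by
  have ht' : (t : ℂ) ∉ L.lattice := hR.ofReal_notMem_lattice ht.1 ht.2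
  have hσt : ‖L.weierstrassSigma t‖ ≠ 0 := norm_ne_zero_iff.mpr (L.weierstrassSigma_ne_zero ht')
  set c := n * (L.quasiPeriodMap L.minRealPeriod).re * (n * (L.minRealPeriod / 2) - n * t) with hc
  -- the division formula at `t` and at `Ω₀ − t`
  have h1 := norm_weierstrassSigma_nat_mul_real hR n t
  have h2 := norm_weierstrassSigma_nat_mul_real hR n (L.minRealPeriod - t)
  rw [hR.weierstrassPRe_minRealPeriod_sub, hR.derivWeierstrassPRe_minRealPeriod_sub,
    show ((n * (L.minRealPeriod - t) : ℝ) : ℂ) = ((n * L.minRealPeriod - n * t : ℝ) : ℂ) by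
      push_cast; ring,
    norm_weierstrassSigma_nat_mul_sub hR n (n * t), h1,
    show ((L.minRealPeriod - t : ℝ) : ℂ) = ((((1 : ℕ) : ℝ) * L.minRealPeriod - t : ℝ) : ℂ) by
      push_cast; ring,
    norm_weierstrassSigma_nat_mul_sub hR 1 t, mul_pow, ← Real.exp_nat_mul,
    show ((n ^ 2 : ℕ) : ℝ) * (((1 : ℕ) : ℝ) * (L.quasiPeriodMap L.minRealPeriod).re *
        (((1 : ℕ) : ℝ) * (L.minRealPeriod / 2) - t)) = c by rw [hc]; push_cast; ring] at h2
  -- cancel `e^c ‖σ t‖^{n²} ≠ 0`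
  have hne : Real.exp c * ‖L.weierstrassSigma t‖ ^ (n ^ 2) ≠ 0 :=
    mul_ne_zero (Real.exp_pos _).ne' (pow_ne_zero _ hσt)
  have key : |((⟨0, 0, 0, -L.g₂.re / 4, -L.g₃.re / 4⟩ : WeierstrassCurve ℝ).ψ n).evalEval
        (L.weierstrassPRe t) (-L.derivWeierstrassPRe t / 2)| *
        (Real.exp c * ‖L.weierstrassSigma t‖ ^ (n ^ 2)) =
      |((⟨0, 0, 0, -L.g₂.re / 4, -L.g₃.re / 4⟩ : WeierstrassCurve ℝ).ψ n).evalEval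
        (L.weierstrassPRe t) (L.derivWeierstrassPRe t / 2)| *
        (Real.exp c * ‖L.weierstrassSigma t‖ ^ (n ^ 2)) := by
    linear_combination (-1 : ℝ) * h2
  exact mul_right_cancel₀ hne key

/-- **The division value of a real point with a rational period** (the heart of the Néron–torsion
identity): if `t ∈ (0, Ω₀)` is real with `(n+1)t = bΩ₀` (`b ∈ ℕ`), then
`log|ψₙ(X t, Y t/2)| = b·η·(bΩ₀/2 − t) − (n² − 1)·log‖σ(t)‖`, `η = Re η(Ω₀)`
(division formula `‖σ(nt)‖ = |ψₙ|‖σ t‖^{n²}` with `nt = bΩ₀ − t` and the quasi-periodicity of `‖σ‖`).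
[cite: Silverman1994, Thm VI.3.2; SilvermanAEC2009, Exercise 6.15] -/
theorem log_abs_evalEval_ψ_of_period (hR : L.IsReal) {t : ℝ} (ht : t ∈ Ioo 0 L.minRealPeriod)
    (n b : ℕ) (hb : ((n : ℝ) + 1) * t = b * L.minRealPeriod) :
    Real.log |((⟨0, 0, 0, -L.g₂.re / 4, -L.g₃.re / 4⟩ : WeierstrassCurve ℝ).ψ n).evalEval
        (L.weierstrassPRe t) (L.derivWeierstrassPRe t / 2)| =
      b * (L.quasiPeriodMap L.minRealPeriod).re * (b * (L.minRealPeriod / 2) - t) -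
        ((n : ℝ) ^ 2 - 1) * Real.log ‖L.weierstrassSigma t‖ := by
  have ht' : (t : ℂ) ∉ L.lattice := hR.ofReal_notMem_lattice ht.1 ht.2
  have hσt : ‖L.weierstrassSigma t‖ ≠ 0 := norm_ne_zero_iff.mpr (L.weierstrassSigma_ne_zero ht')
  have h1 := norm_weierstrassSigma_nat_mul_real hR n t
  rw [show ((n * t : ℝ) : ℂ) = ((b * L.minRealPeriod - t : ℝ) : ℂ) by
      rw [show (n : ℝ) * t = b * L.minRealPeriod - t by linarith [hb]],
    norm_weierstrassSigma_nat_mul_sub hR b t] at h1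
  -- `h1 : e^{E} ‖σ t‖ = |ψ| ‖σ t‖^{n²}`
  have hψ : |((⟨0, 0, 0, -L.g₂.re / 4, -L.g₃.re / 4⟩ : WeierstrassCurve ℝ).ψ n).evalEval
      (L.weierstrassPRe t) (L.derivWeierstrassPRe t / 2)| ≠ 0 := by
    intro h0
    rw [h0, zero_mul] at h1
    exact mul_ne_zero (Real.exp_pos _).ne' hσt h1
  have hlog := congrArg Real.log h1
  rw [Real.log_mul (Real.exp_pos _).ne' hσt, Real.log_exp, Real.log_mul hψ (pow_ne_zero _ hσt),
    Real.log_pow] at hlog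
  push_cast at hlog
  linear_combination (-1 : ℝ) * hlog

/-! ### The value identity -/

/-- **The Néron–torsion value identity** (`NeronTorsionValueIdentity` of the line's on-path workfile
`Cruxes/NeronTorsionFlex/Lines/NeronHeight_onpath.lean`, now a theorem; statement verbatim): for the
real curve `y² = f(x) = 4x³ − g₂x − g₃` (`Δ ≠ 0`, largest root `e₁ > 0`), a point `(x_P, y_P)`,
`x_P > e₁`, with `N·∫_{x_P}^∞ dx/√f = a·(2∫_{e₁}^∞ dx/√f)` (`N ≥ 3`, `0 < a < N/2`), and the
representations `rI = ∫∫_{e₁<x′<x<x_P} x′/(√f√f)`, `rP = ∫∫_{x,x′>e₁} (√f(x))⁻¹(g₂x′+2g₃)/(2x′²√f(x′))`: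
`(N−2)·(4N²·rI.value + (N−2a)²·rP.value) = 4N·log|ψ_{N−1}(x_P, y_P/2)| − N²(N−2)·log(3e₁² − g₂/4)` —
the archimedean Néron local height of the real `N`-torsion point `P`, `λ([N−1]P) = λ(P)`, read in the
tree's integral language. [cite: Silverman1994, Thm VI.1.1, Thm VI.3.2] -/
theorem neronTorsion_value_identity :
    ∀ (g₂ g₃ e₁ xP yP : ℝ) (N a : ℕ) (f : ℝ → ℝ), (∀ x, f x = 4 * x ^ 3 - g₂ * x - g₃) →
    g₂ ^ 3 - 27 * g₃ ^ 2 ≠ 0 → f e₁ = 0 → 0 < e₁ → (∀ x, e₁ < x → 0 < f x) → e₁ < xP →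
    yP ^ 2 = f xP → 3 ≤ N → 0 < a → 2 * a < N →
    (∀ hns : (⟨0, 0, 0, -g₂ / 4, -g₃ / 4⟩ : WeierstrassCurve ℝ).toAffine.Nonsingular xP (yP / 2),
      addOrderOf (WeierstrassCurve.Affine.Point.some xP (yP / 2) hns) = N) →
    (N : ℝ) * (∫ x in Set.Ioi xP, (Real.sqrt (f x))⁻¹) =
      a * (2 * ∫ x in Set.Ioi e₁, (Real.sqrt (f x))⁻¹) →
    ∀ (rI rP : KZ.IntegralRep 2),
      rI.domain = {z | e₁ < z 1 ∧ z 1 < z 0 ∧ z 0 < xP} →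
      Set.EqOn rI.integrand (fun z => z 1 / (Real.sqrt (f (z 1)) * Real.sqrt (f (z 0)))) rI.domain →
      rP.domain = {z | e₁ < z 0 ∧ e₁ < z 1} →
      Set.EqOn rP.integrand
        (fun z => (Real.sqrt (f (z 0)))⁻¹ * ((g₂ * z 1 + 2 * g₃) / (2 * (z 1) ^ 2 * Real.sqrt (f (z 1)))))
        rP.domain →
      ((N : ℝ) - 2) * (4 * (N : ℝ) ^ 2 * rI.value + ((N : ℝ) - 2 * a) ^ 2 * rP.value) =
        4 * (N : ℝ) * Real.log
            |((⟨0, 0, 0, -g₂ / 4, -g₃ / 4⟩ : WeierstrassCurve ℝ).ψ ((N : ℤ) - 1)).evalEval xP (yP / 2)|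
          - (N : ℝ) ^ 2 * ((N : ℝ) - 2) * Real.log (3 * e₁ ^ 2 - g₂ / 4) := by
  intro g₂ g₃ e₁ xP yP N a f hf hΔ hfe he₁ hpos hxP hyP hN _ha _haN _htor hper rI rP hIdom hIint
    hPdom hPint
  -- the real lattice with invariants `g₂, g₃`
  obtain ⟨L, hL2, hL3⟩ :=
    PeriodPair.uniformization_holds (g₂ : ℂ) (g₃ : ℂ) (by exact_mod_cast hΔ)
  have hR : L.IsReal := PeriodPair.isReal_of_g₂_g₃_real PeriodPair.uniformization_unique_holds
    (by rw [hL2]; exact Complex.ofReal_im g₂) (by rw [hL3]; exact Complex.ofReal_im g₃)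
  have hg2 : L.g₂.re = g₂ := by rw [hL2, Complex.ofReal_re]
  have hg3 : L.g₃.re = g₃ := by rw [hL3, Complex.ofReal_re]
  have hfun : f = fun x => 4 * x ^ 3 - g₂ * x - g₃ := funext hf
  subst hfun hg2 hg3
  simp only at hfe hpos hyP hper hIint hPint ⊢
  set T := L.minRealPeriod / 2 with hT
  have hΩ := hR.minRealPeriod_pos
  have hT0 : 0 < T := by positivity
  have hXT : L.weierstrassPRe T = e₁ := weierstrassPRe_half_eq hR hfe hpos
  -- the parameter `u = u_P ∈ (0, T)` of `P`
  have hxP' : xP ∈ Ioi (L.weierstrassPRe (L.minRealPeriod / 2)) := by rw [← hT, hXT]; exact hxP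
  rw [← hR.image_weierstrassPRe_Ioo] at hxP'
  obtain ⟨u, hu, hXu⟩ := hxP'
  have hu' : u ∈ Ioo 0 L.minRealPeriod := ⟨hu.1, by linarith [hu.2]⟩
  have hun : (u : ℂ) ∉ L.lattice := hR.ofReal_notMem_lattice hu'.1 hu'.2
  have hY2 : L.derivWeierstrassPRe u ^ 2 = 4 * xP ^ 3 - L.g₂.re * xP - L.g₃.re := by
    rw [← hXu]; exact hR.derivWeierstrassPRe_sq hun
  -- the two values
  have hI : rI.value = Real.log ‖L.weierstrassSigma ((L.minRealPeriod / 2 : ℝ) : ℂ)‖ -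
      Real.log ‖L.weierstrassSigma u‖ -
      (L.weierstrassZeta ((L.minRealPeriod / 2 : ℝ) : ℂ)).re * (L.minRealPeriod / 2 - u) := by
    rw [value_triangle_eq xP e₁ (fun x => 4 * x ^ 3 - L.g₂.re * x - L.g₃.re) rI hIdom hIint,
      ← iterated_integral_weierstrassPRe hR (by rw [← hT]; exact hu), ← hT, hXT, hXu]
  have hE : ∫ x in Ioi e₁, (L.g₂.re * x + 2 * L.g₃.re) /
      (2 * x ^ 2 * Real.sqrt (4 * x ^ 3 - L.g₂.re * x - L.g₃.re)) =
      2 * (L.weierstrassZeta ((L.minRealPeriod / 2 : ℝ) : ℂ)).re := by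
    rw [← integral_quasiPeriodDensity_eq hR (by rw [← hT, hXT]; exact he₁), ← hT, hXT]
  have hω1 : ∫ x in Ioi xP, (Real.sqrt (4 * x ^ 3 - L.g₂.re * x - L.g₃.re))⁻¹ = u := by
    rw [← hXu]; exact integral_Ioi_weierstrassPRe_eq hR ⟨hu.1, hu.2.le⟩
  have hω2 : ∫ x in Ioi e₁, (Real.sqrt (4 * x ^ 3 - L.g₂.re * x - L.g₃.re))⁻¹ = T := by
    rw [← hXT, hT]; exact hR.integral_Ioi_inv_sqrt_cubic_eq
  have hPv : rP.value = T * (2 * (L.weierstrassZeta ((L.minRealPeriod / 2 : ℝ) : ℂ)).re) := by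
    rw [value_quadrant_eq e₁ e₁ (fun x => (Real.sqrt (4 * x ^ 3 - L.g₂.re * x - L.g₃.re))⁻¹)
      (fun x => (L.g₂.re * x + 2 * L.g₃.re) / (2 * x ^ 2 * Real.sqrt (4 * x ^ 3 - L.g₂.re * x - L.g₃.re)))
      rP hPdom hPint, hω2, hE]
  -- the period relation `N u = a Ω₀`
  rw [hω1, hω2] at hper
  -- the constant at the 2-torsion point and the real quasi-period
  obtain ⟨_, hconst⟩ := four_mul_log_norm_weierstrassSigma_half hR
  rw [← hT, hXT] at hconst
  have hηre : (L.quasiPeriodMap L.minRealPeriod).re =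
      2 * (L.weierstrassZeta ((L.minRealPeriod / 2 : ℝ) : ℂ)).re := by
    rw [quasiPeriodMap_minRealPeriod hR]
    simp [Complex.mul_re]
  rw [hηre] at hconst
  -- the division value at `u`: `log|ψ_{N−1}(x_P, y_P/2)| = aη(aT − u) − (N² − 2N) log‖σ u‖`
  have hN1 : ((N - 1 : ℕ) : ℝ) = (N : ℝ) - 1 := by
    rw [Nat.cast_sub (by omega), Nat.cast_one]
  have hb : (((N - 1 : ℕ) : ℝ) + 1) * u = a * L.minRealPeriod := by
    rw [hN1, hT] at *; linarith [hper]
  have hcore := log_abs_evalEval_ψ_of_period hR hu' (N - 1) a hb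
  have hidx : ((N - 1 : ℕ) : ℤ) = (N : ℤ) - 1 := by omega
  -- the sign of `y_P` is immaterial
  have hsq : yP ^ 2 = L.derivWeierstrassPRe u ^ 2 := by rw [hY2]; exact hyP
  have hcore' : Real.log |((⟨0, 0, 0, -L.g₂.re / 4, -L.g₃.re / 4⟩ : WeierstrassCurve ℝ).ψ
        ((N : ℤ) - 1)).evalEval xP (yP / 2)| =
      a * (L.quasiPeriodMap L.minRealPeriod).re * (a * (L.minRealPeriod / 2) - u) -
        (((N - 1 : ℕ) : ℝ) ^ 2 - 1) * Real.log ‖L.weierstrassSigma u‖ := by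
    rcases sq_eq_sq_iff_eq_or_eq_neg.1 hsq with hy | hy
    · rw [← hcore, hXu, hidx, hy]
    · rw [← hcore, ← abs_evalEval_ψ_neg hR hu' (N - 1), hXu, hidx, hy]
  rw [hηre, hN1] at hcore'
  rw [hI, hPv, hcore']
  rw [hT] at *
  linear_combination ((N : ℝ) ^ 2 * ((N : ℝ) - 2)) * hconst +
    (4 * (L.weierstrassZeta ((L.minRealPeriod / 2 : ℝ) : ℂ)).re * ((N : ℝ) * ((N : ℝ) - 2) + 2 * a)) * hper

end Summit.KontsevichZagierPeriods.KontsevichZagierPeriods.TorsionLogs.NeronHeight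

end
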